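import Mathlib
import HarnessLib
import Literature.Computability.AlgebraicComplexity.StrassenPreorder
import Literature.Computability.AlgebraicComplexity.StrassenPreorderRank
import Literature.Computability.AlgebraicComplexity.StrassenPreorderSubrank
import Literature.Computability.AlgebraicComplexity.StrassenSpectralTheorem

/-!
# OutsiderSandwich — the TOP FIBRE of an asymptotic spectrum: attainment and catalytic localisation
(decomp-mm lens 4 «minimal counterexample / extremal reduction», gen 34, part 1/3: abstract theory)

Route `route-MatrixMultiplication-OutsiderSandwich`; cut of record UNCHANGED:
`closes (h₁ : LaserTangency) (h₂ : LaserMergeOptimal) (h₃ : SummitIffLaserTangency) : ω(ℂ) = 2`,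
`LaserMergeOptimal` (stmt-27897) the declared residual.  Theorem-only, definition-free support.

THE OBJECT.  For a Strassen preorder `≼` on a commutative semiring `S` (Zuiddam 2018 §2) and an
element `a`, the **top fibre** of the asymptotic spectrum `X = X(S, ≼)` at `a` is

  `X_top(a) = {φ ∈ X : φ(a) = R̃(a)}`     (`R̃ = asympRankOf`, `= max_X φ(a)` by Strassen duality).

Every statement of the residual side of the cut is a statement about the top fibre of the tensor
semiring at `a = [⟨2,2,2⟩]` (top points are the universal spectral points with `F⟨2,2,2⟩ = 2^ω`).  The
lens asks for the MINIMAL COUNTEREXAMPLE; this file supplies the two abstract facts that make it exist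
and make it a finite object:

§1 **Attainment** (`isCompact_topFibre`, `exists_top_isMinOn`, `exists_top_isMaxOn`,
   `exists_top_isMinOn_isMinOn`): the top fibre is compact (closed in the compact spectrum,
   Zuiddam Thm. 2.15), so `φ ↦ φ(b)` attains its minimum and maximum on it, and so does any second
   coordinate on the set of minimisers — lexicographically extremal spectral points exist.

§2 **Catalytic localisation = the spectral theorem ON the top fibre** (`exists_gap_of_topLe`,
   `exists_catalyst_of_topLe`, `topLe_iff_catalytic`):

     `(∀ φ ∈ X_top(a), φ(x) ≤ φ(y))  ⟺  ∀ k, ∃ l r ∈ ℕ, r ≤ l·R̃(a) + 2 ∧ k·x + l·a ≼~ k·y + r`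

   (`≼~ = AsympLe`, Zuiddam Def. 2.1).  Reading: an inequality valid only at top points becomes a
   genuine asymptotic relation after adding `l` CATALYTIC copies of `a` on the left, refunded on the
   right by a diagonal of size `l·R̃(a)` (+2): at a top point the catalyst is worth exactly its refund,
   at any other point it is worth `l·δ` less, and that slack pays for `φ(x) − φ(y)`.  Proof: compactness
   gives a uniform `δ` (`exists_gap_of_topLe`), the rank bound `φ(x) ≤ R(x)` fixes `l`, and Strassen's
   spectral theorem (tree: `IsStrassenPreorder.asympLe_iff_forall_spectralPoint`) converts the resulting
   inequality, now valid on ALL of `X`, into `≼~`.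

§3 **Strict inequalities** (`topLt_iff_exists_topLe`, `topLt_iff_catalytic`): by compactness again,
   `(∀ φ ∈ X_top(a), φ(x) < φ(y)) ⟺ ∃ n, ∀ φ ∈ X_top(a), φ(n·x + 1) ≤ φ(n·y)`, whence a catalytic form.

Parts 2/3 (`OutsiderSandwichTopFibreTensor`, `OutsiderSandwichTopSlopeAttained`) specialise to
`T(ℂ)`, `a = [⟨2,2,2⟩]`: the minimal criminal of `LaserMergeOptimal` exists, the top slope `μ*` of
g32 is attained, and `¬ LaserMergeOptimal` is ONE explicit catalytic asymptotic restriction family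
between direct sums of `⟨2,2,2⟩`, `cw₂^{⊠3}` and diagonals.

Nearest prior art (searched: corpus fts+vec "Vergleichsstellensatz preordered semiring catalytic",
"asymptotic spectrum compact faces"; galaxy "Vergleichsstellensatz|catalytic"): Alman–Li–Pratt 2026
(arXiv:2604.01386) §3, Prop. 3.3 / Lemma 3.3 — a closed subset `{φ ≥ f}` of `X` is the spectrum of the
extended preorder `≼_f` with a ZIG-ZAG normal form, and (with Wigderson–Zuiddam Thm. 3.26) `min_Z φ(a)`
is a fractional subrank in `≼_f`; Bugár–Vrana 2025 Thm. 3.23.  The delta here: for the top fibre of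
ONE element the localisation has a ONE-STEP additive-catalytic normal form inside the ORIGINAL
asymptotic preorder, proved from compactness + the rank bound, with no extended preorder.

References: [cite: Zuiddam2018, Thm. 2.12, Thm. 2.15, Cor. 2.13]; [cite: Strassen1988, Thm. 2.3–2.4,
Thm. 3.8]; Alman–Li–Pratt, *The edge of the asymptotic spectrum of tensors*, arXiv:2604.01386 (2026)
§3; Wigderson–Zuiddam, *Asymptotic spectra* (2023) §3 [WigdersonZuiddam2023].
-/

set_option linter.dupNamespace false

namespace Summit.MatrixMultiplication.MatrixMultiplication.Theorems.OutsiderSandwichTopFibre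

open Literature.Computability.AlgebraicComplexity

universe u

variable {S : Type u} [CommSemiring S] {le : S → S → Prop}

/-! ## §1  The top fibre is compact; extremal (and lexicographically extremal) top points exist -/

/-- **The top fibre `{φ ∈ X : φ(a) = R̃(a)}` is compact** (closed in the compact spectrum).
[cite: Zuiddam2018, Thm. 2.15] -/
theorem isCompact_topFibre (h : IsStrassenPreorder le) (a : S) :
    IsCompact ({φ : S → ℝ | IsSpectralPoint le φ} ∩ {φ | φ a = asympRankOf le a}) :=
  h.isCompact_setOf_isSpectralPoint.inter_right (isClosed_eq (continuous_apply a) continuous_const)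

/-- The top fibre at `a` is nonempty as soon as `1 ≼ a` (Strassen duality, attained).
[cite: Zuiddam2018, Cor. 2.13] -/
theorem topFibre_nonempty (h : IsStrassenPreorder le) {a : S} (ha : le 1 a) :
    ∃ φ : S → ℝ, IsSpectralPoint le φ ∧ φ a = asympRankOf le a :=
  h.exists_isSpectralPoint_eq_asympRankOf a ha

/-- **Minimum attained on the top fibre**: if the top fibre at `a` is nonempty, some top point
minimises `φ(b)` among top points. [cite: Zuiddam2018, Thm. 2.15] -/
theorem exists_top_isMinOn (h : IsStrassenPreorder le) {a : S}
    (hne : ∃ φ : S → ℝ, IsSpectralPoint le φ ∧ φ a = asympRankOf le a) (b : S) :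
    ∃ φ : S → ℝ, IsSpectralPoint le φ ∧ φ a = asympRankOf le a ∧
      ∀ ψ, IsSpectralPoint le ψ → ψ a = asympRankOf le a → φ b ≤ ψ b := by
  obtain ⟨φ₁, hφ₁, hφ₁a⟩ := hne
  obtain ⟨φ, hφ, hmin⟩ := (isCompact_topFibre h a).exists_isMinOn ⟨φ₁, hφ₁, hφ₁a⟩
    (continuous_apply b).continuousOn
  exact ⟨φ, hφ.1, hφ.2, fun ψ hψ hψa => hmin ⟨hψ, hψa⟩⟩

/-- **Maximum attained on the top fibre.** [cite: Zuiddam2018, Thm. 2.15] -/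
theorem exists_top_isMaxOn (h : IsStrassenPreorder le) {a : S}
    (hne : ∃ φ : S → ℝ, IsSpectralPoint le φ ∧ φ a = asympRankOf le a) (b : S) :
    ∃ φ : S → ℝ, IsSpectralPoint le φ ∧ φ a = asympRankOf le a ∧
      ∀ ψ, IsSpectralPoint le ψ → ψ a = asympRankOf le a → ψ b ≤ φ b := by
  obtain ⟨φ₁, hφ₁, hφ₁a⟩ := hne
  obtain ⟨φ, hφ, hmax⟩ := (isCompact_topFibre h a).exists_isMaxOn ⟨φ₁, hφ₁, hφ₁a⟩
    (continuous_apply b).continuousOn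
  exact ⟨φ, hφ.1, hφ.2, fun ψ hψ hψa => hmax ⟨hψ, hψa⟩⟩

/-- **Lexicographic extremal points** (the lens's normal form): among the top points minimising
`φ(b)` there is one minimising `φ(c)` — the set of `b`-minimisers is again compact.
[cite: Zuiddam2018, Thm. 2.15] -/
theorem exists_top_isMinOn_isMinOn (h : IsStrassenPreorder le) {a : S}
    (hne : ∃ φ : S → ℝ, IsSpectralPoint le φ ∧ φ a = asympRankOf le a) (b c : S) :
    ∃ φ : S → ℝ, IsSpectralPoint le φ ∧ φ a = asympRankOf le a ∧
      (∀ ψ, IsSpectralPoint le ψ → ψ a = asympRankOf le a → φ b ≤ ψ b) ∧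
      (∀ ψ, IsSpectralPoint le ψ → ψ a = asympRankOf le a → ψ b = φ b → φ c ≤ ψ c) := by
  obtain ⟨φ₀, hφ₀, hφ₀a, hφ₀min⟩ := exists_top_isMinOn h hne b
  -- the set of `b`-minimisers inside the top fibre is compact and contains `φ₀`
  have hK : IsCompact (({φ : S → ℝ | IsSpectralPoint le φ} ∩ {φ | φ a = asympRankOf le a}) ∩
      {φ | φ b = φ₀ b}) :=
    (isCompact_topFibre h a).inter_right (isClosed_eq (continuous_apply b) continuous_const)
  obtain ⟨φ, hφ, hmin⟩ := hK.exists_isMinOn ⟨φ₀, ⟨hφ₀, hφ₀a⟩, rfl⟩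
    (continuous_apply c).continuousOn
  refine ⟨φ, hφ.1.1, hφ.1.2, fun ψ hψ hψa => ?_, fun ψ hψ hψa hψb => ?_⟩
  · have e : φ b = φ₀ b := hφ.2
    rw [e]; exact hφ₀min ψ hψ hψa
  · have e : φ b = φ₀ b := hφ.2
    exact hmin ⟨⟨hψ, hψa⟩, by rw [Set.mem_setOf_eq, hψb, e]⟩

/-! ## §2  Catalytic localisation: the spectral theorem on the top fibre -/

/-- **Uniform gap (compactness).**  If `φ(x) ≤ φ(y)` at every top point, then for some `δ > 0`
every spectral point `δ`-close to the top has `φ(x) ≤ φ(y) + 1`.  (The compact set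
`{φ ∈ X : φ(y) + 1 ≤ φ(x)}` misses the top fibre, so `φ(a)` stays boundedly below `R̃(a)` on it.)
[cite: Zuiddam2018, Thm. 2.15] -/
theorem exists_gap_of_topLe (h : IsStrassenPreorder le) {a x y : S}
    (H : ∀ φ, IsSpectralPoint le φ → φ a = asympRankOf le a → φ x ≤ φ y) :
    ∃ δ : ℝ, 0 < δ ∧
      ∀ φ, IsSpectralPoint le φ → asympRankOf le a - δ < φ a → φ x ≤ φ y + 1 := by
  have hK : IsCompact ({φ : S → ℝ | IsSpectralPoint le φ} ∩ {φ | φ y + 1 ≤ φ x}) :=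
    h.isCompact_setOf_isSpectralPoint.inter_right
      (isClosed_le ((continuous_apply y).add continuous_const) (continuous_apply x))
  by_cases hne : ({φ : S → ℝ | IsSpectralPoint le φ} ∩ {φ | φ y + 1 ≤ φ x}).Nonempty
  · obtain ⟨φ₀, hφ₀, hmax⟩ := hK.exists_isMaxOn hne (continuous_apply a).continuousOn
    have hφ₀A : φ₀ a ≤ asympRankOf le a := hφ₀.1.le_asympRankOf h a
    have hφ₀ne : φ₀ a ≠ asympRankOf le a := by
      intro htop
      have h1 := H φ₀ hφ₀.1 htop
      have h2 : φ₀ y + 1 ≤ φ₀ x := hφ₀.2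
      linarith
    have hlt : φ₀ a < asympRankOf le a := lt_of_le_of_ne hφ₀A hφ₀ne
    refine ⟨asympRankOf le a - φ₀ a, sub_pos.2 hlt, fun φ hφ hclose => ?_⟩
    by_contra hxy
    have hmem : φ ∈ {φ : S → ℝ | IsSpectralPoint le φ} ∩ {φ | φ y + 1 ≤ φ x} :=
      ⟨hφ, by simp only [Set.mem_setOf_eq]; linarith⟩
    have h3 : φ a ≤ φ₀ a := hmax hmem
    linarith
  · refine ⟨1, one_pos, fun φ hφ _ => ?_⟩
    by_contra hxy
    exact hne ⟨φ, hφ, by simp only [Set.mem_setOf_eq]; linarith⟩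

/-- **One catalytic step.**  If `φ(x) ≤ φ(y)` on the top fibre at `a`, then for some `l, r ∈ ℕ`
with `r ≤ l·R̃(a) + 2`:  `x + l·a ≼~ y + r`. [cite: Zuiddam2018, Thm. 2.12, Thm. 2.15] -/
theorem exists_catalyst_of_topLe (h : IsStrassenPreorder le) {a x y : S}
    (H : ∀ φ, IsSpectralPoint le φ → φ a = asympRankOf le a → φ x ≤ φ y) :
    ∃ l r : ℕ, (r : ℝ) ≤ l * asympRankOf le a + 2 ∧
      AsympLe le (x + (l : S) * a) (y + (r : S)) := by
  obtain ⟨δ, hδ, hgap⟩ := exists_gap_of_topLe h H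
  set A := asympRankOf le a with hA
  have hA0 : 0 ≤ A := IsStrassenPreorder.asympRankOf_nonneg le a
  -- the catalyst multiplicity: `R(x) ≤ l δ`
  obtain ⟨l, hl⟩ : ∃ l : ℕ, (rankOf le x : ℝ) ≤ l * δ := by
    obtain ⟨l, hl⟩ := exists_nat_ge ((rankOf le x : ℝ) / δ)
    exact ⟨l, by rwa [div_le_iff₀ hδ] at hl⟩
  -- the linear inequality, valid at EVERY spectral point
  have hlin : ∀ φ, IsSpectralPoint le φ → φ x + l * φ a ≤ φ y + (l * A + 1) := by
    intro φ hφ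
    have hxB : φ x ≤ rankOf le x := hφ.le_rankOf h x
    have haA : φ a ≤ A := hφ.le_asympRankOf h a
    have hy0 : 0 ≤ φ y := hφ.nonneg h y
    have hx0 : 0 ≤ φ x := hφ.nonneg h x
    have hl0 : (0 : ℝ) ≤ l := Nat.cast_nonneg l
    have hlaA : (l : ℝ) * φ a ≤ l * A := mul_le_mul_of_nonneg_left haA hl0
    by_cases hc : A - δ < φ a
    · have h1 := hgap φ hφ hc
      linarith
    · push Not at hc
      have h2 : (l : ℝ) * φ a ≤ l * (A - δ) := mul_le_mul_of_nonneg_left hc hl0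
      nlinarith
  -- the refund `r`
  obtain ⟨r, hr1, hr2⟩ : ∃ r : ℕ, (l : ℝ) * A + 1 ≤ r ∧ (r : ℝ) ≤ l * A + 2 := by
    have h0 : 0 ≤ (l : ℝ) * A + 1 := by positivity
    refine ⟨⌈(l : ℝ) * A + 1⌉₊, Nat.le_ceil _, ?_⟩
    have := Nat.ceil_lt_add_one h0
    linarith
  refine ⟨l, r, hr2, h.asympLe_of_forall_spectralPoint _ _ fun φ hφ => ?_⟩
  rw [hφ.map_add, hφ.map_add, hφ.map_mul, hφ.map_natCast, hφ.map_natCast]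
  linarith [hlin φ hφ]

/-- **THE SPECTRAL THEOREM ON THE TOP FIBRE (catalytic localisation).**  For a Strassen preorder
`≼` and `a, x, y ∈ S`:
`(∀ φ ∈ X with φ(a) = R̃(a), φ(x) ≤ φ(y)) ⟺ ∀ k, ∃ l r ∈ ℕ, r ≤ l·R̃(a) + 2 ∧ k·x + l·a ≼~ k·y + r`.
[cite: Zuiddam2018, Thm. 2.12, Thm. 2.15; Strassen1988, Thm. 2.4] -/
theorem topLe_iff_catalytic (h : IsStrassenPreorder le) (a x y : S) :
    (∀ φ, IsSpectralPoint le φ → φ a = asympRankOf le a → φ x ≤ φ y) ↔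
    ∀ k : ℕ, ∃ l r : ℕ, (r : ℝ) ≤ l * asympRankOf le a + 2 ∧
      AsympLe le ((k : S) * x + (l : S) * a) ((k : S) * y + (r : S)) := by
  constructor
  · intro H k
    exact exists_catalyst_of_topLe h (x := (k : S) * x) (y := (k : S) * y) fun φ hφ hφa => by
      rw [hφ.map_mul, hφ.map_mul, hφ.map_natCast]
      exact mul_le_mul_of_nonneg_left (H φ hφ hφa) (Nat.cast_nonneg k)
  · intro H φ hφ hφa
    refine le_of_forall_pos_lt_add fun ε hε => ?_
    obtain ⟨k, hk⟩ := exists_nat_gt (2 / ε)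
    obtain ⟨l, r, hr, hle⟩ := H k
    have hineq := (h.asympLe_iff_forall_spectralPoint.1 hle) φ hφ
    simp only [hφ.map_add, hφ.map_mul, hφ.map_natCast, hφa] at hineq
    have hk0 : (0 : ℝ) < k := lt_trans (by positivity) hk
    have h1 : (k : ℝ) * (φ x - φ y) ≤ 2 := by nlinarith
    have h2 : 2 < (k : ℝ) * ε := by
      have := (div_lt_iff₀ hε).1 hk
      linarith
    by_contra hcon
    push Not at hcon
    have h3 : (k : ℝ) * ε ≤ (k : ℝ) * (φ x - φ y) :=
      mul_le_mul_of_nonneg_left (by linarith) hk0.le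
    linarith

/-! ## §3  Strict inequalities on the top fibre -/

/-- **Strict inequalities are uniformly strict** (compactness of the top fibre):
`(∀ top φ, φ(x) < φ(y)) ⟺ ∃ n, ∀ top φ, φ(n·x + 1) ≤ φ(n·y)`. [cite: Zuiddam2018, Thm. 2.15] -/
theorem topLt_iff_exists_topLe (h : IsStrassenPreorder le) (a x y : S) :
    (∀ φ, IsSpectralPoint le φ → φ a = asympRankOf le a → φ x < φ y) ↔
    ∃ n : ℕ, ∀ φ, IsSpectralPoint le φ → φ a = asympRankOf le a →
      φ ((n : S) * x + 1) ≤ φ ((n : S) * y) := by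
  constructor
  · intro H
    by_cases hne : ({φ : S → ℝ | IsSpectralPoint le φ} ∩ {φ | φ a = asympRankOf le a}).Nonempty
    · obtain ⟨φ₀, hφ₀, hmin⟩ := (isCompact_topFibre h a).exists_isMinOn hne
        ((continuous_apply y).sub (continuous_apply x)).continuousOn
      have hm : 0 < φ₀ y - φ₀ x := sub_pos.2 (H φ₀ hφ₀.1 hφ₀.2)
      obtain ⟨n, hn⟩ := exists_nat_ge (1 / (φ₀ y - φ₀ x))
      refine ⟨n, fun φ hφ hφa => ?_⟩
      have h1 : φ₀ y - φ₀ x ≤ φ y - φ x := by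
        have := hmin (⟨hφ, hφa⟩ : φ ∈ {φ : S → ℝ | IsSpectralPoint le φ} ∩
          {φ | φ a = asympRankOf le a})
        simpa using this
      rw [hφ.map_add, hφ.map_mul, hφ.map_natCast, hφ.map_one, hφ.map_mul, hφ.map_natCast]
      have h2 : 1 ≤ (n : ℝ) * (φ₀ y - φ₀ x) := by rwa [div_le_iff₀ hm] at hn
      have hn0 : (0 : ℝ) ≤ n := Nat.cast_nonneg n
      nlinarith [mul_le_mul_of_nonneg_left h1 hn0]
    · refine ⟨0, fun φ hφ hφa => absurd (⟨φ, hφ, hφa⟩ : ({φ : S → ℝ | IsSpectralPoint le φ} ∩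
        {φ | φ a = asympRankOf le a}).Nonempty) hne⟩
  · rintro ⟨n, hn⟩ φ hφ hφa
    have h1 := hn φ hφ hφa
    rw [hφ.map_add, hφ.map_mul, hφ.map_natCast, hφ.map_one, hφ.map_mul, hφ.map_natCast] at h1
    have hn0 : (0 : ℝ) ≤ n := Nat.cast_nonneg n
    by_contra hge
    push Not at hge
    nlinarith [mul_le_mul_of_nonneg_left hge hn0]

/-- **Catalytic form of a strict top-fibre inequality**:
`(∀ top φ, φ(x) < φ(y)) ⟺ ∃ n, ∀ k, ∃ l r ∈ ℕ, r ≤ l·R̃(a) + 2 ∧ k·(n·x + 1) + l·a ≼~ k·(n·y) + r`.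
[cite: Zuiddam2018, Thm. 2.12, Thm. 2.15] -/
theorem topLt_iff_catalytic (h : IsStrassenPreorder le) (a x y : S) :
    (∀ φ, IsSpectralPoint le φ → φ a = asympRankOf le a → φ x < φ y) ↔
    ∃ n : ℕ, ∀ k : ℕ, ∃ l r : ℕ, (r : ℝ) ≤ l * asympRankOf le a + 2 ∧
      AsympLe le ((k : S) * ((n : S) * x + 1) + (l : S) * a) ((k : S) * ((n : S) * y) + (r : S)) := by
  rw [topLt_iff_exists_topLe h a x y]
  exact exists_congr fun n => topLe_iff_catalytic h a _ _

end Summit.MatrixMultiplication.MatrixMultiplication.Theorems.OutsiderSandwichTopFibre
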